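import Mathlib

/-!
# Simplex-vertex recursion for the Jacobi spectral-weight density — elementary kernel anchors

Kernel-checked elementary steps of Lemma 5.8 of the repair-cell note
`pub-imbrie/b2b-imbrie-2/DENSITY-XY.md` §5.4 (ADDENDUM C), which drives the perturbative
vertex recursion (Theorem 5.7 there) for the push-forward density `K_n` of Lebesgue measure
under the spectral map of an `n`-site Jacobi matrix, written in the first-site spectral
weights `w ∈ Δ_{n-1}` and the Hankel determinants `D_k(w) = Σ_{|S|=k} ∏_{i∈S} w_i Δ(ν_S)²`.

* `weightedVariance_ge_of_isolated` — Lemma 5.8(c): if every level `ν j`, `j ≠ i₀`, is at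
  distance `≥ G` from `ν i₀`, then the variance of the measure `Σ w_j δ_{ν_j}` is
  `≥ (G²/4)·min(w i₀, 1 - w i₀)` (the covering of the constraint set by vertex neighbourhoods).
* `sub_sq_le_of_isolated`, `doubleSum_domination_two` — Lemma 5.8(b) at `k = 2`
  (with the better constant): `Σ_i Σ_j v_i v_j (ν_i-ν_j)² ≤ (4/G²)(Σ_j v_j (ν_j - z)²)²`.
* `vertexIdentity₃_D2`, `vertexIdentity₃_D3`, `vertexIdentity₄_D2`, `vertexIdentity₄_D3`,
  `vertexIdentity₄_D4` — Lemma 5.8(a), the exact vertex identity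
  `D_k(w) = (1-t) t^{k-1} D̃_{k-1}(ṽ) + t^k D_k(v)` under `w = (1-t, t·v)`, `ṽ_j = v_j (ν_j-ν_0)²`,
  written out for `n = 3, 4` (the cases used for the four-level target T4).

No new definitions; no `sorry`.
-/

namespace Literature.MathematicalPhysics.QuantumLattice.Imbrie2016

open Finset

/-- Lemma 5.8(c) (variance / covering). For a probability vector `w` on `Fin n` and levels `ν`
with `|ν j - ν i₀| ≥ G` for all `j ≠ i₀` (`G ≥ 0`), the variance of `Σ_j w_j δ_{ν_j}` is at least
`(G²/4)·min (w i₀) (1 - w i₀)` (DENSITY-XY Lemma 5.8(c)).  [cite: ImbrieJSP2016, §4.2.1]  [folklore] -/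
theorem weightedVariance_ge_of_isolated {n : ℕ} (w ν : Fin n → ℝ) (i₀ : Fin n) (G : ℝ)
    (hG : 0 ≤ G) (hw : ∀ j, 0 ≤ w j) (hsum : ∑ j, w j = 1)
    (hiso : ∀ j, j ≠ i₀ → G ≤ |ν j - ν i₀|) :
    G ^ 2 / 4 * min (w i₀) (1 - w i₀) ≤ ∑ j, w j * (ν j - ∑ k, w k * ν k) ^ 2 := by
  set m := ∑ k, w k * ν k with hm
  have hG4 : G ^ 2 / 4 = (G / 2) ^ 2 := by ring
  by_cases hcase : G / 2 ≤ |m - ν i₀|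
  · have h1 : w i₀ * (ν i₀ - m) ^ 2 ≤ ∑ j, w j * (ν j - m) ^ 2 :=
      Finset.single_le_sum (f := fun j => w j * (ν j - m) ^ 2)
        (fun j _ => mul_nonneg (hw j) (sq_nonneg _)) (Finset.mem_univ i₀)
    have h2 : (G / 2) ^ 2 ≤ (ν i₀ - m) ^ 2 := by
      have h : (G / 2) ^ 2 ≤ |m - ν i₀| ^ 2 := by
        nlinarith [hcase, abs_nonneg (m - ν i₀)]
      rw [sq_abs] at h
      have e : (m - ν i₀) ^ 2 = (ν i₀ - m) ^ 2 := by ring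
      rw [e] at h
      exact h
    have h3 : min (w i₀) (1 - w i₀) ≤ w i₀ := min_le_left _ _
    calc G ^ 2 / 4 * min (w i₀) (1 - w i₀) ≤ G ^ 2 / 4 * w i₀ := by
          apply mul_le_mul_of_nonneg_left h3; positivity
      _ = w i₀ * (G / 2) ^ 2 := by ring
      _ ≤ w i₀ * (ν i₀ - m) ^ 2 := mul_le_mul_of_nonneg_left h2 (hw i₀)
      _ ≤ _ := h1
  · rw [not_le] at hcase
    have hterm : ∀ j, j ≠ i₀ → w j * (G / 2) ^ 2 ≤ w j * (ν j - m) ^ 2 := by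
      intro j hj
      apply mul_le_mul_of_nonneg_left _ (hw j)
      have hG2 : G / 2 ≤ |ν j - m| := by
        have h := hiso j hj
        have tri : |ν j - ν i₀| ≤ |ν j - m| + |m - ν i₀| := abs_sub_le (ν j) m (ν i₀)
        linarith
      have h : (G / 2) ^ 2 ≤ |ν j - m| ^ 2 := by
        nlinarith [hG2, abs_nonneg (ν j - m)]
      rw [sq_abs] at h
      exact h
    have hsplit : ∑ j, w j * (ν j - m) ^ 2
        = w i₀ * (ν i₀ - m) ^ 2 + ∑ j ∈ univ.erase i₀, w j * (ν j - m) ^ 2 := by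
      rw [← Finset.add_sum_erase Finset.univ (fun j => w j * (ν j - m) ^ 2) (Finset.mem_univ i₀)]
    have hsplit' : ∑ j, w j = w i₀ + ∑ j ∈ univ.erase i₀, w j := by
      rw [← Finset.add_sum_erase Finset.univ (fun j => w j) (Finset.mem_univ i₀)]
    have hw' : ∑ j ∈ univ.erase i₀, w j = 1 - w i₀ := by linarith
    have hrest : (1 - w i₀) * (G / 2) ^ 2 ≤ ∑ j ∈ univ.erase i₀, w j * (ν j - m) ^ 2 := by
      rw [← hw', Finset.sum_mul]
      apply Finset.sum_le_sum
      intro j hj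
      exact hterm j (Finset.ne_of_mem_erase hj)
    have h3 : min (w i₀) (1 - w i₀) ≤ 1 - w i₀ := min_le_right _ _
    have hnn : 0 ≤ w i₀ * (ν i₀ - m) ^ 2 := mul_nonneg (hw i₀) (sq_nonneg _)
    calc G ^ 2 / 4 * min (w i₀) (1 - w i₀) ≤ G ^ 2 / 4 * (1 - w i₀) := by
          apply mul_le_mul_of_nonneg_left h3; positivity
      _ = (1 - w i₀) * (G / 2) ^ 2 := by ring
      _ ≤ ∑ j ∈ univ.erase i₀, w j * (ν j - m) ^ 2 := hrest
      _ ≤ ∑ j, w j * (ν j - m) ^ 2 := by rw [hsplit]; linarith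

/-- Pair lemma behind Lemma 5.8(b): if `x` and `y` are both at distance `≥ G > 0` from `z`, then
`(x - y)² ≤ 4 (x - z)² (y - z)² / G²`.  [folklore] -/
theorem sub_sq_le_of_isolated (x y z G : ℝ) (hG : 0 < G)
    (hx : G ^ 2 ≤ (x - z) ^ 2) (hy : G ^ 2 ≤ (y - z) ^ 2) :
    (x - y) ^ 2 ≤ 4 / G ^ 2 * ((x - z) ^ 2 * (y - z) ^ 2) := by
  have hG2 : 0 < G ^ 2 := by positivity
  set a := (x - z) ^ 2 with ha
  set b := (y - z) ^ 2 with hb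
  have ha0 : 0 ≤ a := sq_nonneg _
  have hb0 : 0 ≤ b := sq_nonneg _
  -- (x - y)² ≤ 2a + 2b
  have h1 : (x - y) ^ 2 ≤ 2 * a + 2 * b := by
    have : (x - y) ^ 2 + ((x - z) + (y - z)) ^ 2 = 2 * (x - z) ^ 2 + 2 * (y - z) ^ 2 := by ring
    nlinarith [sq_nonneg ((x - z) + (y - z))]
  -- a ≤ a b / G², b ≤ a b / G²
  have h2 : a * G ^ 2 ≤ a * b := mul_le_mul_of_nonneg_left hy ha0
  have h3 : b * G ^ 2 ≤ a * b := by
    calc b * G ^ 2 = G ^ 2 * b := by ring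
      _ ≤ a * b := mul_le_mul_of_nonneg_right hx hb0
  rw [div_mul_eq_mul_div, le_div_iff₀ hG2]
  nlinarith [h1, h2, h3]

/-- Lemma 5.8(b) at `k = 2` (double-sum form, constant 4 in place of the note's cruder bound):
for nonnegative weights `v` and levels all at distance `≥ G` from `z`,
`Σ_i Σ_j v_i v_j (ν_i - ν_j)² ≤ (4/G²) · (Σ_j v_j (ν_j - z)²)²`; the left side is `2·D₂(v)`
and the right side is `(4/G²)·m̃²` in the notation of the note.  [cite: ImbrieJSP2016, §4.2.1]  [folklore] -/
theorem doubleSum_domination_two {n : ℕ} (v ν : Fin n → ℝ) (z G : ℝ) (hG : 0 < G)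
    (hv : ∀ j, 0 ≤ v j) (hiso : ∀ j, G ^ 2 ≤ (ν j - z) ^ 2) :
    ∑ i, ∑ j, v i * v j * (ν i - ν j) ^ 2
      ≤ 4 / G ^ 2 * (∑ j, v j * (ν j - z) ^ 2) ^ 2 := by
  have hterm : ∀ i j, v i * v j * (ν i - ν j) ^ 2
      ≤ 4 / G ^ 2 * ((v i * (ν i - z) ^ 2) * (v j * (ν j - z) ^ 2)) := by
    intro i j
    have hp := sub_sq_le_of_isolated (ν i) (ν j) z G hG (hiso i) (hiso j)
    have hvv : 0 ≤ v i * v j := mul_nonneg (hv i) (hv j)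
    calc v i * v j * (ν i - ν j) ^ 2
        ≤ v i * v j * (4 / G ^ 2 * ((ν i - z) ^ 2 * (ν j - z) ^ 2)) :=
          mul_le_mul_of_nonneg_left hp hvv
      _ = 4 / G ^ 2 * ((v i * (ν i - z) ^ 2) * (v j * (ν j - z) ^ 2)) := by ring
  calc ∑ i, ∑ j, v i * v j * (ν i - ν j) ^ 2
      ≤ ∑ i, ∑ j, 4 / G ^ 2 * ((v i * (ν i - z) ^ 2) * (v j * (ν j - z) ^ 2)) :=
        Finset.sum_le_sum (fun i _ => Finset.sum_le_sum (fun j _ => hterm i j))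
    _ = 4 / G ^ 2 * (∑ j, v j * (ν j - z) ^ 2) ^ 2 := by
        have e : (∑ j, v j * (ν j - z) ^ 2) ^ 2
            = ∑ i, ∑ j, (v i * (ν i - z) ^ 2) * (v j * (ν j - z) ^ 2) := by
          rw [sq (∑ j, v j * (ν j - z) ^ 2), Finset.sum_mul_sum]
        rw [e, Finset.mul_sum]
        refine Finset.sum_congr rfl (fun i _ => ?_)
        rw [Finset.mul_sum]

/-! ### Lemma 5.8(a): the exact vertex identity, written out for `n = 3` and `n = 4`
(`i₀ = 0`; `w = (1-t, t v₁, …)`, `c_j = (ν_j - ν_0)²`, `ṽ_j = c_j v_j`). -/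

/-- `n = 3`, `k = 2`: `D₂(w) = (1-t)·t·(c₁v₁ + c₂v₂) + t²·(v₁v₂(ν₂-ν₁)²)` (Cauchy–Binet for Hankel determinants).  [cite: ImbrieJSP2016, §4.2.1; Dumitriu–Edelman 2002, Lemma 2.7]  [folklore] -/
theorem vertexIdentity₃_D2 (t v₁ v₂ ν₀ ν₁ ν₂ : ℝ) :
    (1 - t) * (t * v₁) * (ν₁ - ν₀) ^ 2 + (1 - t) * (t * v₂) * (ν₂ - ν₀) ^ 2
      + (t * v₁) * (t * v₂) * (ν₂ - ν₁) ^ 2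
    = (1 - t) * t * ((ν₁ - ν₀) ^ 2 * v₁ + (ν₂ - ν₀) ^ 2 * v₂)
      + t ^ 2 * (v₁ * v₂ * (ν₂ - ν₁) ^ 2) := by
  ring

/-- `n = 3`, `k = 3`: `D₃(w) = w₀w₁w₂Δ(ν)² = (1-t)·t²·(ṽ₁ṽ₂(ν₂-ν₁)²) + t³·0`.  [folklore] -/
theorem vertexIdentity₃_D3 (t v₁ v₂ ν₀ ν₁ ν₂ : ℝ) :
    (1 - t) * (t * v₁) * (t * v₂) * ((ν₁ - ν₀) ^ 2 * (ν₂ - ν₀) ^ 2 * (ν₂ - ν₁) ^ 2)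
    = (1 - t) * t ^ 2 * (((ν₁ - ν₀) ^ 2 * v₁) * ((ν₂ - ν₀) ^ 2 * v₂) * (ν₂ - ν₁) ^ 2)
      + t ^ 3 * 0 := by
  ring

/-- `n = 4`, `k = 2` (the case used for the four-level target T4).  [cite: ImbrieJSP2016, §4.2.1]  [folklore] -/
theorem vertexIdentity₄_D2 (t v₁ v₂ v₃ ν₀ ν₁ ν₂ ν₃ : ℝ) :
    (1 - t) * (t * v₁) * (ν₁ - ν₀) ^ 2 + (1 - t) * (t * v₂) * (ν₂ - ν₀) ^ 2
      + (1 - t) * (t * v₃) * (ν₃ - ν₀) ^ 2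
      + (t * v₁) * (t * v₂) * (ν₂ - ν₁) ^ 2 + (t * v₁) * (t * v₃) * (ν₃ - ν₁) ^ 2
      + (t * v₂) * (t * v₃) * (ν₃ - ν₂) ^ 2
    = (1 - t) * t * ((ν₁ - ν₀) ^ 2 * v₁ + (ν₂ - ν₀) ^ 2 * v₂ + (ν₃ - ν₀) ^ 2 * v₃)
      + t ^ 2 * (v₁ * v₂ * (ν₂ - ν₁) ^ 2 + v₁ * v₃ * (ν₃ - ν₁) ^ 2
               + v₂ * v₃ * (ν₃ - ν₂) ^ 2) := by
  ring

/-- `n = 4`, `k = 3`: the triples through the vertex give `(1-t)t²·D₂(ṽ)`, the triple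
`{1,2,3}` gives `t³·D₃(v)`.  [folklore] -/
theorem vertexIdentity₄_D3 (t v₁ v₂ v₃ ν₀ ν₁ ν₂ ν₃ : ℝ) :
    (1 - t) * (t * v₁) * (t * v₂) * ((ν₁ - ν₀) ^ 2 * (ν₂ - ν₀) ^ 2 * (ν₂ - ν₁) ^ 2)
      + (1 - t) * (t * v₁) * (t * v₃) * ((ν₁ - ν₀) ^ 2 * (ν₃ - ν₀) ^ 2 * (ν₃ - ν₁) ^ 2)
      + (1 - t) * (t * v₂) * (t * v₃) * ((ν₂ - ν₀) ^ 2 * (ν₃ - ν₀) ^ 2 * (ν₃ - ν₂) ^ 2)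
      + (t * v₁) * (t * v₂) * (t * v₃) * ((ν₂ - ν₁) ^ 2 * (ν₃ - ν₁) ^ 2 * (ν₃ - ν₂) ^ 2)
    = (1 - t) * t ^ 2 *
        (((ν₁ - ν₀) ^ 2 * v₁) * ((ν₂ - ν₀) ^ 2 * v₂) * (ν₂ - ν₁) ^ 2
          + ((ν₁ - ν₀) ^ 2 * v₁) * ((ν₃ - ν₀) ^ 2 * v₃) * (ν₃ - ν₁) ^ 2
          + ((ν₂ - ν₀) ^ 2 * v₂) * ((ν₃ - ν₀) ^ 2 * v₃) * (ν₃ - ν₂) ^ 2)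
      + t ^ 3 * (v₁ * v₂ * v₃ * ((ν₂ - ν₁) ^ 2 * (ν₃ - ν₁) ^ 2 * (ν₃ - ν₂) ^ 2)) := by
  ring

/-- `n = 4`, `k = 4`: `D₄(w) = (∏ w)Δ(ν)² = (1-t)t³·D₃(ṽ) + t⁴·0`.  [folklore] -/
theorem vertexIdentity₄_D4 (t v₁ v₂ v₃ ν₀ ν₁ ν₂ ν₃ : ℝ) :
    (1 - t) * (t * v₁) * (t * v₂) * (t * v₃) *
        ((ν₁ - ν₀) ^ 2 * (ν₂ - ν₀) ^ 2 * (ν₃ - ν₀) ^ 2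
          * (ν₂ - ν₁) ^ 2 * (ν₃ - ν₁) ^ 2 * (ν₃ - ν₂) ^ 2)
    = (1 - t) * t ^ 3 *
        (((ν₁ - ν₀) ^ 2 * v₁) * ((ν₂ - ν₀) ^ 2 * v₂) * ((ν₃ - ν₀) ^ 2 * v₃)
          * ((ν₂ - ν₁) ^ 2 * (ν₃ - ν₁) ^ 2 * (ν₃ - ν₂) ^ 2))
      + t ^ 4 * 0 := by
  ring

end Literature.MathematicalPhysics.QuantumLattice.Imbrie2016
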